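import Literature.MathematicalPhysics.QuantumLattice.WilsonBlockHeatBathSemigroup
import Literature.MathematicalPhysics.QuantumLattice.WilsonBlockHeatBathMarkov3
import Literature.MathematicalPhysics.QuantumLattice.WilsonBlockHeatBathLightCone
import HarnessLib

/-!
# The overlapping block heat-bath sampler of the torus Wilson theory — Poincaré sector and local subspaces

Theorems (no definitions) for the block heat-bath dynamics of `wilsonMeasure ρ β` on `L²(μ)` (Martinelli 1999 §3,
block dynamics; vocabulary `WilsonBlockHeatBath.lean`, bookkeeping `WilsonBlockHeatBathSemigroup.lean`): with the
heat-bath projections `E_z` and the generator `H = ∑_z (1 − E_z)`,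

* `poincare_form` — `GlobalPoincare ρ β N b γ` in `L²` language: `γ ‖F − ∫F‖² ≤ ⟪H F, F⟫` on bounded measurable
  gauge-invariant `F`;
* `exists_invariantSector` — the closed `H`-invariant MEAN-ZERO GAUGE-INVARIANT SECTOR `W ⊆ L²(μ)` on which
  `γ‖x‖² ≤ ⟪Hx, x⟫`, containing `F − ∫F` for all such `F` (closure of the bounded invariant functions intersected with
  `1^⊥`; `E_z`-invariance by the gauge-invariant versions of conditional expectations, tree `…Markov3`);
* `exists_localSubspaces` — the LOCAL SUBSPACES `M R ⊆ L²(μ)` of the light cone (closure of the bounded measurable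
  functions of the links in the `4`-cell windows of the blocks of `R`): closed, monotone, MARKOV
  (`E_z M R ⊆ M (R ∪ {z})`, locality of the plaquette-action conditional expectations), fixed by `E_z` when `z` is at
  index distance `≥ 3` from `R` in some axis, and containing the local observables of the blocks they meet.

References: F. Martinelli, *Lectures on Glauber dynamics for discrete spin models*, LNM 1717 (1999), §3 (spectral gap,
block dynamics, finite speed of propagation).  Deliberately NOT here: the semigroup contraction
`‖P_t x‖ ≤ e^{−γt}‖x‖` on `W` and the Dyson light cone (abstract operator facts supplied elsewhere).
-/

open scoped BigOperators InnerProductSpace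
open _root_.MeasureTheory _root_.Filter _root_.Topology
open Literature.MathematicalPhysics.QuantumFieldTheory Literature.MathematicalPhysics.QuantumLattice
open Literature.Probability.LatticeModels (gibbsSpecOfPotential isSpecification_gibbsSpecOfPotential
  Torus.proj Torus.proj_apply)
open Literature.Analysis.OperatorTheory.KnabeDevice (cdist)

noncomputable section

namespace Literature.MathematicalPhysics.QuantumLattice.WilsonBlockHeatBath

/-! ## Part F: the Poincaré inequality on the mean-zero invariant subspace -/
section Poincare

variable {G : Type} [Group G] [TopologicalSpace G] [IsTopologicalGroup G] [CompactSpace G]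
  [MeasurableSpace G] [BorelSpace G] [SecondCountableTopology G] {N Nρ : ℕ} [NeZero N]
  (ρ : G →* Matrix (Fin Nρ) (Fin Nρ) ℂ) (β : ℝ)
  [hfact : ∀ S : Set (Edge 4 N), Fact (linkSigma (G := G) S ≤
    (MeasurableSpace.pi : MeasurableSpace (GaugeConfig 4 N G)))]
  (μ : Measure (GaugeConfig 4 N G)) [IsProbabilityMeasure μ]

omit [SecondCountableTopology G] in
/-- **The block Dirichlet form dominates `γ ×` the variance** on bounded measurable gauge-invariant
functions: `GlobalPoincare` in `L²` language, `γ ‖F − ∫F‖² ≤ ⟪∑_z (1 − E_z) F, F⟫`. [cite: Martinelli1999, §3] -/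
theorem poincare_form {b : ℕ} {γ : ℝ} (hγ : 0 < γ) (hGP : GlobalPoincare ρ β N b γ)
    (hμ : μ = wilsonMeasure (d := 4) (L := N) ρ β) {F : GaugeConfig 4 N G → ℝ} (hFm : Measurable F)
    (hC : ∃ C, ∀ U, |F U| ≤ C) (hFi : IsGaugeInvariant F) (hF2 : MemLp F 2 μ) :
    γ * ‖hF2.toLp F - Lp.const 2 μ (∫ U, F U ∂μ)‖ ^ 2 ≤
      ⟪(∑ z : Fin 4 → Fin (N / b), (1 - (lpMeas ℝ ℝ (extSigma G N (N / b) z) 2 μ).starProjection))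
        (hF2.toLp F), hF2.toLp F⟫_ℝ := by
  subst hμ
  have hP := hGP F hFm hC hFi
  -- left-hand side
  have e1 : ((hF2.toLp F - Lp.const 2 (wilsonMeasure (d := 4) (L := N) ρ β)
      (∫ U, F U ∂wilsonMeasure (d := 4) (L := N) ρ β) : Lp ℝ 2 _) : GaugeConfig 4 N G → ℝ)
      =ᵐ[wilsonMeasure (d := 4) (L := N) ρ β]
      fun U => F U - ∫ V, F V ∂wilsonMeasure (d := 4) (L := N) ρ β :=
    (Lp.coeFn_sub _ _).trans (hF2.coeFn_toLp.sub (Lp.coeFn_const 2 _ _))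
  have hL : ‖hF2.toLp F - Lp.const 2 (wilsonMeasure (d := 4) (L := N) ρ β)
      (∫ U, F U ∂wilsonMeasure (d := 4) (L := N) ρ β)‖ ^ 2 =
      ∫ U, (F U - ∫ V, F V ∂wilsonMeasure (d := 4) (L := N) ρ β) ^ 2
        ∂wilsonMeasure (d := 4) (L := N) ρ β := norm_sq_eq_integral_sq _ e1
  -- right-hand side
  have hR : ⟪(∑ z : Fin 4 → Fin (N / b), (1 - (lpMeas ℝ ℝ (extSigma G N (N / b) z) 2
      (wilsonMeasure (d := 4) (L := N) ρ β)).starProjection)) (hF2.toLp F), hF2.toLp F⟫_ℝ =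
      ∑ z : Fin 4 → Fin (N / b), ∫ U, (F U - ((wilsonMeasure (d := 4) (L := N) ρ β)[F|
        extSigma G N (N / b) z]) U) ^ 2 ∂wilsonMeasure (d := 4) (L := N) ρ β := by
    rw [sum_apply, sum_inner]
    refine Finset.sum_congr rfl fun z _ => ?_
    rw [inner_one_sub_starProjection, norm_sub_starProjection_sq]
    refine integral_congr_ae ?_
    filter_upwards [hF2.coeFn_toLp, condExp_congr_ae (m := extSigma G N (N / b) z) hF2.coeFn_toLp]
      with U h1 h2
    rw [h1, h2]
  rw [hL, hR]
  calc γ * ∫ U, (F U - ∫ V, F V ∂wilsonMeasure (d := 4) (L := N) ρ β) ^ 2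
        ∂wilsonMeasure (d := 4) (L := N) ρ β
      ≤ γ * (γ⁻¹ * ∑ z : Fin 4 → Fin (N / b), ∫ U, (F U - ((wilsonMeasure (d := 4) (L := N) ρ β)[F|
        extSigma G N (N / b) z]) U) ^ 2 ∂wilsonMeasure (d := 4) (L := N) ρ β) :=
        mul_le_mul_of_nonneg_left hP hγ.le
    _ = _ := by rw [← mul_assoc, mul_inv_cancel₀ hγ.ne', one_mul]

/-- **The mean-zero gauge-invariant sector**: a closed subspace `W ⊆ L²(μ)`, invariant under the
block generator `H = ∑_z (1 − E_z)`, on which `γ ‖x‖² ≤ ⟪H x, x⟫`, containing `F − ∫F` for every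
bounded measurable gauge-invariant `F`. [cite: Martinelli1999, §3] -/
theorem exists_invariantSector (hρ : Continuous ρ) {b : ℕ} {γ : ℝ} (hγ : 0 < γ)
    (hGP : GlobalPoincare ρ β N b γ) (hμ : μ = wilsonMeasure (d := 4) (L := N) ρ β) :
    ∃ W : Submodule ℝ (Lp ℝ 2 μ), IsClosed (W : Set (Lp ℝ 2 μ)) ∧
      (∀ x ∈ W, (∑ z : Fin 4 → Fin (N / b),
        (1 - (lpMeas ℝ ℝ (extSigma G N (N / b) z) 2 μ).starProjection)) x ∈ W) ∧
      (∀ x ∈ W, γ * ‖x‖ ^ 2 ≤ ⟪(∑ z : Fin 4 → Fin (N / b),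
        (1 - (lpMeas ℝ ℝ (extSigma G N (N / b) z) 2 μ).starProjection)) x, x⟫_ℝ) ∧
      ∀ (F : GaugeConfig 4 N G → ℝ), Measurable F → (∃ C, ∀ U, |F U| ≤ C) → IsGaugeInvariant F →
        ∀ hF2 : MemLp F 2 μ, hF2.toLp F - Lp.const 2 μ (∫ U, F U ∂μ) ∈ W := by
  set P : (Fin 4 → Fin (N / b)) → (Lp ℝ 2 μ →L[ℝ] Lp ℝ 2 μ) := fun z =>
    (lpMeas ℝ ℝ (extSigma G N (N / b) z) 2 μ).starProjection with hPdef
  set H : Lp ℝ 2 μ →L[ℝ] Lp ℝ 2 μ := ∑ z : Fin 4 → Fin (N / b), (1 - P z) with hHdef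
  set one : Lp ℝ 2 μ := Lp.const 2 μ (1 : ℝ) with hone
  -- the generating subspace of bounded measurable invariant functions
  let W' : Submodule ℝ (Lp ℝ 2 μ) :=
    { carrier := {x | ∃ (F : GaugeConfig 4 N G → ℝ) (h2 : MemLp F 2 μ), Measurable F ∧
        (∃ C, ∀ U, |F U| ≤ C) ∧ IsGaugeInvariant F ∧ x = h2.toLp F}
      zero_mem' := ⟨fun _ => 0, memLp_const 0, measurable_const, ⟨0, fun U => by simp⟩,
        fun _ _ => rfl, by rw [MemLp.toLp_const, map_zero]⟩
      add_mem' := by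
        rintro x y ⟨F, hF2, hFm, ⟨C, hC⟩, hFi, rfl⟩ ⟨F', hF2', hFm', ⟨C', hC'⟩, hFi', rfl⟩
        refine ⟨F + F', hF2.add hF2', hFm.add hFm', ⟨C + C', fun U => ?_⟩, fun g U => ?_,
          (MemLp.toLp_add hF2 hF2').symm⟩
        · exact (abs_add_le _ _).trans (add_le_add (hC U) (hC' U))
        · simp only [Pi.add_apply, hFi g U, hFi' g U]
      smul_mem' := by
        rintro c x ⟨F, hF2, hFm, ⟨C, hC⟩, hFi, rfl⟩
        refine ⟨c • F, hF2.const_smul c, hFm.const_smul c, ⟨|c| * C, fun U => ?_⟩, fun g U => ?_,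
          (MemLp.toLp_const_smul c hF2).symm⟩
        · rw [Pi.smul_apply, smul_eq_mul, abs_mul]
          exact mul_le_mul_of_nonneg_left (hC U) (abs_nonneg c)
        · simp only [Pi.smul_apply, hFi g U] }
  have hW'mem : ∀ {x : Lp ℝ 2 μ}, x ∈ W' ↔ ∃ (F : GaugeConfig 4 N G → ℝ) (h2 : MemLp F 2 μ),
      Measurable F ∧ (∃ C, ∀ U, |F U| ≤ C) ∧ IsGaugeInvariant F ∧ x = h2.toLp F := Iff.rfl
  set W₁ := W'.topologicalClosure with hW₁
  set ℓ : Lp ℝ 2 μ →L[ℝ] ℝ := innerSL ℝ one with hℓ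
  have hℓ_apply : ∀ x, ℓ x = ⟪one, x⟫_ℝ := fun x => rfl
  -- basic operator facts
  have hPone : ∀ z, P z one = one := fun z => starProjection_const μ 1
  have hHapply : ∀ x, H x = ∑ z, (x - P z x) := fun x => by
    simp only [hHdef, sum_apply, sub_apply, one_apply_eq_self]
  have hHone : H one = 0 := by
    rw [hHapply]; exact Finset.sum_eq_zero fun z _ => by rw [hPone, sub_self]
  have hHsa : IsSelfAdjoint H := by
    rw [hHdef]
    refine isSelfAdjoint_sum _ fun z _ => ?_
    exact (IsSelfAdjoint.one _).sub (isSelfAdjoint_starProjection _)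
  have hℓH : ∀ x, ℓ (H x) = 0 := fun x => by
    have h := hHsa.isSymmetric one x
    simp only [ContinuousLinearMap.coe_coe] at h
    rw [hℓ_apply, ← h, hHone, inner_zero_left]
  -- invariance of `W'` under each `P z`
  have hPW' : ∀ z, ∀ x ∈ W', P z x ∈ W' := by
    rintro z x ⟨F, hF2, hFm, ⟨C, hC⟩, hFi, rfl⟩
    obtain ⟨F', hF'm, hF'C, hF'i, hF'ae⟩ := exists_isGaugeInvariant_version_condExp_linkSigma ρ hρ β
      {e | ¬ InBlock N (N / b) z e.1} hFm hC hFi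
    rw [← hμ] at hF'ae
    have hF'2 : MemLp F' 2 μ := MemLp.of_bound hF'm.aestronglyMeasurable C
      (ae_of_all _ fun U => by rw [Real.norm_eq_abs]; exact hF'C U)
    refine ⟨F', hF'2, hF'm, ⟨C, hF'C⟩, hF'i, Lp.ext ?_⟩
    refine (starProjection_ae_eq_condExp μ (m := extSigma G N (N / b) z) (hF2.toLp F)).trans ?_
    refine (condExp_congr_ae (m := extSigma G N (N / b) z) hF2.coeFn_toLp).trans ?_
    exact hF'ae.symm.trans hF'2.coeFn_toLp.symm
  -- invariance of the closure
  have hPW₁ : ∀ z, ∀ x ∈ W₁, P z x ∈ W₁ := by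
    intro z
    have hle : W' ≤ W₁.comap (P z : Lp ℝ 2 μ →ₗ[ℝ] Lp ℝ 2 μ) := fun x hx =>
      Submodule.mem_comap.2 (W'.le_topologicalClosure (hPW' z x hx))
    have hcl : IsClosed ((W₁.comap (P z : Lp ℝ 2 μ →ₗ[ℝ] Lp ℝ 2 μ) : Set (Lp ℝ 2 μ))) :=
      IsClosed.preimage (P z).continuous W'.isClosed_topologicalClosure
    intro x hx
    exact Submodule.mem_comap.1 (W'.topologicalClosure_minimal hle hcl hx)
  have hHW₁ : ∀ x ∈ W₁, H x ∈ W₁ := fun x hx => by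
    rw [hHapply]; exact Submodule.sum_mem _ fun z _ => Submodule.sub_mem _ hx (hPW₁ z x hx)
  -- the sector
  refine ⟨W₁ ⊓ LinearMap.ker (ℓ : Lp ℝ 2 μ →ₗ[ℝ] ℝ), ?_, ?_, ?_, ?_⟩
  · rw [Submodule.coe_inf]
    exact W'.isClosed_topologicalClosure.inter (ContinuousLinearMap.isClosed_ker ℓ)
  · rintro x ⟨hx1, hx2⟩
    exact ⟨hHW₁ x hx1, LinearMap.mem_ker.2 (hℓH x)⟩
  · rintro x ⟨hx1, hx2⟩
    have hx0 : ℓ x = 0 := LinearMap.mem_ker.1 hx2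
    -- the closed set on which the (shifted) inequality holds
    have hcont : Continuous fun y : Lp ℝ 2 μ => γ * ‖y - (ℓ y) • one‖ ^ 2 := by fun_prop
    have hcont' : Continuous fun y : Lp ℝ 2 μ => ⟪H y, y⟫_ℝ :=
      Continuous.inner H.continuous continuous_id
    have hC₀ : IsClosed {y : Lp ℝ 2 μ | γ * ‖y - (ℓ y) • one‖ ^ 2 ≤ ⟪H y, y⟫_ℝ} :=
      isClosed_le hcont hcont'
    have hsub : (W' : Set (Lp ℝ 2 μ)) ⊆ {y | γ * ‖y - (ℓ y) • one‖ ^ 2 ≤ ⟪H y, y⟫_ℝ} := by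
      rintro y ⟨F, hF2, hFm, hC, hFi, rfl⟩
      have hℓF : ℓ (hF2.toLp F) = ∫ U, F U ∂μ := by
        rw [hℓ_apply, hone, inner_const_one_left]
        exact integral_congr_ae hF2.coeFn_toLp
      have hsmul : (ℓ (hF2.toLp F)) • one = Lp.const 2 μ (∫ U, F U ∂μ) := by
        rw [hℓF, hone, smul_Lp_const_one]
      show γ * ‖hF2.toLp F - (ℓ (hF2.toLp F)) • one‖ ^ 2 ≤ ⟪H (hF2.toLp F), hF2.toLp F⟫_ℝ
      rw [hsmul, hHdef, hPdef]
      exact poincare_form ρ β μ hγ hGP hμ hFm hC hFi hF2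
    have hx1' : x ∈ {y : Lp ℝ 2 μ | γ * ‖y - (ℓ y) • one‖ ^ 2 ≤ ⟪H y, y⟫_ℝ} := by
      have : (W₁ : Set (Lp ℝ 2 μ)) ⊆ {y : Lp ℝ 2 μ | γ * ‖y - (ℓ y) • one‖ ^ 2 ≤ ⟪H y, y⟫_ℝ} := by
        rw [hW₁, Submodule.topologicalClosure_coe]; exact closure_minimal hsub hC₀
      exact this hx1
    simpa [hx0] using hx1'
  · intro F hFm hC hFi hF2
    obtain ⟨C, hC'⟩ := hC
    have h1 : hF2.toLp F ∈ W' := ⟨F, hF2, hFm, ⟨C, hC'⟩, hFi, rfl⟩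
    have h2 : Lp.const 2 μ (∫ U, F U ∂μ) ∈ W' :=
      ⟨fun _ => ∫ U, F U ∂μ, memLp_const _, measurable_const, ⟨|∫ U, F U ∂μ|, fun U => le_rfl⟩,
        fun _ _ => rfl, (MemLp.toLp_const 2 μ _).symm⟩
    refine ⟨W'.le_topologicalClosure (Submodule.sub_mem _ h1 h2), LinearMap.mem_ker.2 ?_⟩
    rw [map_sub]
    simp only [ContinuousLinearMap.coe_coe]
    rw [hℓ_apply, hℓ_apply, hone, inner_const_one_left, inner_const_one_left,
      integral_congr_ae hF2.coeFn_toLp, integral_congr_ae (Lp.coeFn_const 2 μ _)]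
    simp

end Poincare

/-! ## Part G: the local subspaces of the light cone -/
section LocalSubspaces

variable {G : Type} [Group G] [TopologicalSpace G] [IsTopologicalGroup G] [CompactSpace G]
  [MeasurableSpace G] [BorelSpace G] [SecondCountableTopology G] [T2Space G] {N Nρ : ℕ} [NeZero N]
  (ρ : G →* Matrix (Fin Nρ) (Fin Nρ) ℂ) (β : ℝ)
  [hfact : ∀ S : Set (Edge 4 N), Fact (linkSigma (G := G) S ≤
    (MeasurableSpace.pi : MeasurableSpace (GaugeConfig 4 N G)))]
  (μ : Measure (GaugeConfig 4 N G)) [IsProbabilityMeasure μ]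

omit [NeZero N] in
/-- The three base sites of a plaquette are pairwise lattice neighbours (coordinatewise). [folklore] -/
theorem nbr_of_mem_plaquetteSites (y : Site 4 N) {i j : Fin 4} (hij : i < j) {x x' : Site 4 N}
    (hx : x = y ∨ x = y.shift i ∨ x = y.shift j) (hx' : x' = y ∨ x' = y.shift i ∨ x' = y.shift j)
    (k : Fin 4) : x' k = x k ∨ x' k = x k + 1 ∨ x k = x' k + 1 := by
  have hne : i ≠ j := hij.ne
  rcases hx with rfl | rfl | rfl <;> rcases hx' with rfl | rfl | rfl <;>
    simp only [Site.shift, Pi.add_apply, Pi.single_apply] <;>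
    (by_cases hki : k = i <;> by_cases hkj : k = j) <;> subst_vars <;> simp_all

/-- **The local subspaces `M R` of the light cone** for the overlapping block heat bath:
`M R` = closure of the bounded measurable functions of the links in the index-`1`-neighbourhood
(the `4`-cell windows) of the blocks of `R`; they are closed, monotone, each `E_z` maps `M R` into
`M (R ∪ {z})` (Markov property of the plaquette action) and fixes `M R` when `z` is at index
distance `≥ 3` from `R` in some axis; local observables belong to the `M` of the blocks they
meet. [cite: Martinelli1999, §3] -/
theorem exists_localSubspaces (hρ : Continuous ρ) (hμ : μ = wilsonMeasure (d := 4) (L := N) ρ β)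
    {m : ℕ} (hm : 4 < m) (hmN : m ≤ N) :
    ∃ M : Finset (Fin 4 → Fin m) → Submodule ℝ (Lp ℝ 2 μ),
      (∀ R, IsClosed (M R : Set (Lp ℝ 2 μ))) ∧
      (∀ R R', R ⊆ R' → M R ≤ M R') ∧
      (∀ (z : Fin 4 → Fin m) (R : Finset (Fin 4 → Fin m)), ∀ x ∈ M R,
        (lpMeas ℝ ℝ (extSigma G N m z) 2 μ).starProjection x ∈ M (insert z R)) ∧
      (∀ (z : Fin 4 → Fin m) (R : Finset (Fin 4 → Fin m)),
        (∀ w ∈ R, ¬ (∀ k, cdist (z k) (w k) ≤ 2)) →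
        ∀ x ∈ M R, (lpMeas ℝ ℝ (extSigma G N m z) 2 μ).starProjection x = x) ∧
      (∀ (F : GaugeConfig 4 N G → ℝ) (hF2 : MemLp F 2 μ) (T : Finset (Edge 4 N))
        (R₀ : Finset (Fin 4 → Fin m)), Measurable F → (∃ C, ∀ U, |F U| ≤ C) → DependsOn F ↑T →
        (∀ z, (∃ e ∈ T, InBlock N m z e.1) → z ∈ R₀) → hF2.toLp F ∈ M R₀) := by
  classical
  haveI : NeZero m := ⟨by omega⟩
  -- the link windows of a set of blocks and the generating sets
  set Reg : Finset (Fin 4 → Fin m) → Set (Edge 4 N) := fun R =>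
    {e | ∃ w ∈ R, ∀ k, (cellOf N m (e.1 k) - ((w k : ℕ) : ZMod m) + 1).val ≤ 3} with hReg
  set S : Finset (Fin 4 → Fin m) → Set (Lp ℝ 2 μ) := fun R =>
    {x | ∃ (F : GaugeConfig 4 N G → ℝ) (h2 : MemLp F 2 μ), Measurable F ∧ (∃ C, ∀ U, |F U| ≤ C) ∧
      DependsOn F (Reg R) ∧ x = h2.toLp F} with hS
  have hRegmono : ∀ R R', R ⊆ R' → Reg R ⊆ Reg R' := fun R R' h e ⟨w, hw, hwin⟩ => ⟨w, h hw, hwin⟩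
  have hSmono : ∀ R R', R ⊆ R' → S R ⊆ S R' := by
    rintro R R' h x ⟨F, h2, hFm, hC, hdep, rfl⟩
    exact ⟨F, h2, hFm, hC, hdep.mono (hRegmono R R' h), rfl⟩
  set P : (Fin 4 → Fin m) → (Lp ℝ 2 μ →L[ℝ] Lp ℝ 2 μ) := fun z =>
    (lpMeas ℝ ℝ (extSigma G N m z) 2 μ).starProjection with hPdef
  refine ⟨fun R => (Submodule.span ℝ (S R)).topologicalClosure, fun R => Submodule.isClosed_topologicalClosure _,
    fun R R' h => Submodule.topologicalClosure_mono (Submodule.span_mono (hSmono R R' h)), ?_, ?_, ?_⟩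
  · -- Markov property
    intro z R
    -- generators are mapped to generators
    have hgen : ∀ x ∈ S R, P z x ∈ S (insert z R) := by
      rintro x ⟨F, hF2, hFm, ⟨C, hC⟩, hdep, rfl⟩
      set Λ : Finset (Edge 4 N) := Finset.univ.filter fun e => InBlock N m z e.1 with hΛ
      have hT : ∀ (y : Site 4 N) (i j : Fin 4), i < j →
          (({(y, i), (y.shift i, j), (y.shift j, i), (y, j)} : Finset (Edge 4 N)) ∩ Λ).Nonempty →
          (↑({(y, i), (y.shift i, j), (y.shift j, i), (y, j)} : Finset (Edge 4 N)) : Set (Edge 4 N)) ⊆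
            ↑Λ ∪ Reg (insert z R) := by
        intro y i j hij hne e' he'
        obtain ⟨e, he⟩ := hne
        rw [Finset.mem_inter] at he
        have hzb : InBlock N m z e.1 := (Finset.mem_filter.1 he.2).2
        have hsites : ∀ {e'' : Edge 4 N}, e'' ∈ ({(y, i), (y.shift i, j), (y.shift j, i), (y, j)} :
            Finset (Edge 4 N)) → e''.1 = y ∨ e''.1 = y.shift i ∨ e''.1 = y.shift j := by
          intro e'' h
          simp only [Finset.mem_insert, Finset.mem_singleton] at h
          rcases h with rfl | rfl | rfl | rfl <;> simp
        refine Or.inr ⟨z, Finset.mem_insert_self _ _, fun k => ?_⟩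
        exact window_of_inBlock_of_nbr (by omega) hmN hzb
          (nbr_of_mem_plaquetteSites y hij (hsites he.1) (hsites (Finset.mem_coe.1 he'))) k
      have hdep' : DependsOn F (↑Λ ∪ Reg (insert z R)) :=
        hdep.mono ((hRegmono R _ (Finset.subset_insert z R)).trans Set.subset_union_right)
      obtain ⟨F', hF'm, hF'C, hF'dep, hF'ae⟩ :=
        exists_local_condExp_version ρ hρ β Λ hT hFm hC hdep'
      have hF'2 : MemLp F' 2 μ := MemLp.of_bound hF'm.aestronglyMeasurable C
        (ae_of_all _ fun U => by rw [Real.norm_eq_abs]; exact hF'C U)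
      refine ⟨F', hF'2, hF'm, ⟨C, hF'C⟩, hF'dep, Lp.ext ?_⟩
      have hσ : extSigma G N m z = cylinderEvents (X := fun _ : Edge 4 N => G) ((↑Λ : Set (Edge 4 N))ᶜ) := by
        rw [show ((↑Λ : Set (Edge 4 N))ᶜ) = {e | ¬ InBlock N m z e.1} by ext e; simp [hΛ]]
        exact linkSigma_eq_cylinderEvents _
      refine (starProjection_ae_eq_condExp μ (m := extSigma G N m z) (hF2.toLp F)).trans ?_
      refine (condExp_congr_ae (m := extSigma G N m z) hF2.coeFn_toLp).trans ?_
      rw [hσ]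
      have h' : F' =ᵐ[μ] μ[F | cylinderEvents (X := fun _ : Edge 4 N => G) ((↑Λ : Set (Edge 4 N))ᶜ)] := by
        rw [hμ]; exact hF'ae
      exact h'.symm.trans hF'2.coeFn_toLp.symm
    -- pass to the closed span
    set Tz : Submodule ℝ (Lp ℝ 2 μ) :=
      ((Submodule.span ℝ (S (insert z R))).topologicalClosure).comap (P z : Lp ℝ 2 μ →ₗ[ℝ] Lp ℝ 2 μ)
      with hTz
    have hcl : IsClosed (Tz : Set (Lp ℝ 2 μ)) :=
      IsClosed.preimage (P z).continuous (Submodule.isClosed_topologicalClosure _)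
    have hle : Submodule.span ℝ (S R) ≤ Tz := Submodule.span_le.2 fun x hx =>
      Submodule.mem_comap.2 (Submodule.le_topologicalClosure _ (Submodule.subset_span (hgen x hx)))
    intro x hx
    exact Submodule.mem_comap.1 (Submodule.topologicalClosure_minimal _ hle hcl hx)
  · -- far blocks act trivially
    intro z R hfar
    have hK : IsClosed ((lpMeas ℝ ℝ (extSigma G N m z) 2 μ : Submodule ℝ (Lp ℝ 2 μ)) : Set (Lp ℝ 2 μ)) :=
      (completeSpace_coe_iff_isComplete.1
        (inferInstanceAs (CompleteSpace (lpMeas ℝ ℝ (extSigma G N m z) 2 μ)))).isClosed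
    have hle : Submodule.span ℝ (S R) ≤ lpMeas ℝ ℝ (extSigma G N m z) 2 μ := by
      refine Submodule.span_le.2 ?_
      rintro x ⟨F, hF2, hFm, hC, hdep, rfl⟩
      have hsub : Reg R ⊆ {e | ¬ InBlock N m z e.1} := by
        rintro e ⟨w, hw, hwin⟩ hzb
        exact hfar w hw fun k => cdist_le_two_of_window_of_inBlock hm hzb hwin k
      have hmeas : Measurable[extSigma G N m z] F := by
        rw [show extSigma G N m z = cylinderEvents (X := fun _ : Edge 4 N => G) {e | ¬ InBlock N m z e.1}
          from linkSigma_eq_cylinderEvents _]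
        exact hFm.measurable_cylinderEvents_of_dependsOn (hdep.mono hsub)
      exact toLp_mem_lpMeas μ hmeas hF2
    intro x hx
    exact Submodule.starProjection_eq_self_iff.2 (Submodule.topologicalClosure_minimal _ hle hK hx)
  · -- local observables
    intro F hF2 T R₀ hFm hC hdep hR₀
    refine Submodule.le_topologicalClosure _ (Submodule.subset_span ⟨F, hF2, hFm, hC, ?_, rfl⟩)
    refine hdep.mono fun e he => ?_
    obtain ⟨z, hz⟩ := exists_inBlock (m := m) e.1
    exact ⟨z, hR₀ z ⟨e, he, hz⟩, fun k => window_of_inBlock (by omega) hz k⟩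

end LocalSubspaces

end Literature.MathematicalPhysics.QuantumLattice.WilsonBlockHeatBath

end
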